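import Mathlib
import HarnessLib
import Literature.Analysis.FluidPDE.SuitableWeak
import Literature.Analysis.FluidPDE.SelfSimilar
import Literature.Analysis.FluidPDE.LocalTypeI
import Literature.Analysis.FluidPDE.VectorCalculus
import Literature.Analysis.FluidPDE.IsometryInvariance
import Literature.Analysis.FluidPDE.OseenZoomCovariance
import Literature.Analysis.FluidPDE.KNSSTypeIRateLiouvilleHolds
import Literature.Analysis.FluidPDE.NSLocalLerayBackwardUniqueness
import Literature.Analysis.UnboundedOperators.HeatKernel
import Summits.NavierStokesRegularity.NavierStokesRegularity.Theses.LocalSineTubeDoor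
import Summits.NavierStokesRegularity.NavierStokesRegularity.Theorems.LocalSineTubeDoorProfileAlignedWindowRigidityPlanarity
import Summits.NavierStokesRegularity.NavierStokesRegularity.Theorems.LocalSineTubeDoorProfileAlignedWindowRigidityAncient

/-!
# Route `LocalSineTubeDoor`, crux `ProfileAlignedWindowRigidity` (stmt-NavierStokesRegularity-20018) — PROVED
# file 3/3: the Type-I planar Liouville step and the route decl

Port to `Theorems/` of the cell proof
`Summit.NavierStokesRegularity.NavierStokesRegularity.Cell.NsRegP1c.profileAlignedWindowRigidity_holds`
(cell ns-regularity-ideate, seat p1, `Sketch5.lean` L3245 / `Sketch8A.lean`, kernel-checked there; landed by seat p6,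
`--supports stmt-NavierStokesRegularity-20018`; the final theorem's type is LITERALLY the route decl
`Summit.NavierStokesRegularity.NavierStokesRegularity.Theses.LocalSineTubeDoor.ProfileAlignedWindowRigidity`).

RIGIDITY OF TYPE-I PROFILES WITH AN ALIGNED WINDOW.  Let `v : (−∞,0) × ℝ³ → ℝ³` have the Type-I time rate
`‖v(t,x)‖ ≤ C/√(−t)`, be continuous on the open slab, unit-viscosity Oseen-mild between any two negative times and
divergence-free.  Then `curl v(−1,·)` is continuous, and if `curl v(−1,y) × e = 0` for all `y` in a nonempty open
`U` (some `e ≠ 0`), then `v(t,·) ≡ 0` for every `t < 0`.  Chain (all tree + the two companion files):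

1. (E) slice analyticity (`…Ancient.analyticOnNhd_slice`) + `curl` analytic (tree `analyticOnNhd_curl`) + identity theorem
   (`…Planarity.cross_eq_zero_spread`): alignment spreads from the window to all of `ℝ³` at time `s`
   (`cross_curl_eq_zero_of_window`);
2. (S)+(D) slice planarity (`…Planarity.translate_eq_of_cross_curl_eq_zero` with the gradient bound
   `…Ancient.exists_fderiv_slice_bound`): `v(s)` is invariant under translations along `e`;
3. (F)+(T) the invariance propagates to every `t < 0` (`…Ancient.translate_eq_forward/backward`);
4. (N₁) ANCIENT PLANAR LIOUVILLE WITH THE TYPE-I RATE (`eq_zero_of_translate_eq`): the tree THEOREM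
   `KNSS2009_typeI_rate_liouville_holds` (Koch–Nadirashvili–Seregin–Šverák 2009, proof of Thm 6.2, arXiv p. 13:
   planar descent + Thm 5.1 + Remark 6.1 + caloric Liouville), stated along the axis `e₂` for globally bounded
   fields, transported to an arbitrary direction `e ≠ 0` by the reflection exchanging `e₂` and `e/‖e‖`
   (`Submodule.reflection_sub`; covariance `heatExtension_conj_linearIsometryEquiv`,
   `oseenDuhamel_symm_conj_linearIsometryEquiv`, `IsDivFree.conj_linearIsometryEquiv`) and to the
   sub-slab-bounded class by the time shift `t ↦ t − δ` (`…Ancient.shift`), under which the rate only improves.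

Sources: KNSS 2009 (arXiv:0709.3599) Thm 5.1 / proof of Thm 6.2; Giga–Miura 2011 (doi:10.1007/s00220-011-1197-x)
§2 (unidirectional ⇒ 2D ⇒ Liouville); Lemarié-Rieusset 2016 Thm 9.12 (analyticity); Seregin 2014 §6.3 (gauge).
WHAT THIS IS NOT: not a claim about Navier–Stokes regularity; it closes the support cone of ONE crux
(rank 3, `provable-now`) of a DRAFT rung-leaf route whose open input is the local zoom `LocalPointZoom`.
-/

noncomputable section

open Set Filter Function MeasureTheory Metric
open scoped Topology ENNReal
open Literature.Analysis Literature.Analysis.FluidPDE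
open Summit.NavierStokesRegularity.NavierStokesRegularity.Theorems.LocalSineTubeDoorProfileAlignedWindowRigidityPlanarity
open Summit.NavierStokesRegularity.NavierStokesRegularity.Theorems.LocalSineTubeDoorProfileAlignedWindowRigidityAncient

namespace Summit.NavierStokesRegularity.NavierStokesRegularity.Theorems.LocalSineTubeDoorProfileAlignedWindowRigidity

variable {v : ℝ → (EuclideanSpace ℝ (Fin 3)) → (EuclideanSpace ℝ (Fin 3))}

/-- **(E′) alignment spreads over the slice**: for an Oseen-ancient field and `s < 0`, if `curl v(s) × e = 0`
on a nonempty open set then `curl v(s) × e = 0` on all of `ℝ³` (slice analyticity + identity theorem). -/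
theorem cross_curl_eq_zero_of_window (hcont : ContinuousOn (uncurry v) (Iio (0 : ℝ) ×ˢ univ))
    (hbdd : ∀ δ : ℝ, 0 < δ → ∃ B : ℝ, ∀ t < -δ, ∀ y : (EuclideanSpace ℝ (Fin 3)), ‖v t y‖ ≤ B)
    (hmild : ∀ s t : ℝ, s < t → t < 0 → ∀ y : (EuclideanSpace ℝ (Fin 3)),
      v t y = UnboundedOperators.heatExtension (v s) (t - s) y - oseenDuhamel 1 s v v t y)
    {s : ℝ} (hs : s < 0) (e : (EuclideanSpace ℝ (Fin 3))) {U : Set (EuclideanSpace ℝ (Fin 3))} (hU : IsOpen U) (hne : U.Nonempty)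
    (h : ∀ y ∈ U, cross (curl (v s) y) e = 0) : ∀ y, cross (curl (v s) y) e = 0 :=
  cross_eq_zero_spread (analyticOnNhd_curl (analyticOnNhd_slice hcont hbdd hmild hs)) e hU hne h

/-- **(S)+(D)+(F)+(T)**: for an Oseen-ancient field with divergence-free slices, if `curl v(s) × e = 0` on all
of `ℝ³` at ONE time `s < 0`, then EVERY slice `v(t)`, `t < 0`, is invariant under translations along `e`. -/
theorem translate_eq_of_cross_curl_eq_zero_slice
    (hcont : ContinuousOn (uncurry v) (Iio (0 : ℝ) ×ˢ univ))
    (hbdd : ∀ δ : ℝ, 0 < δ → ∃ B : ℝ, ∀ t < -δ, ∀ y : (EuclideanSpace ℝ (Fin 3)), ‖v t y‖ ≤ B)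
    (hmild : ∀ s t : ℝ, s < t → t < 0 → ∀ y : (EuclideanSpace ℝ (Fin 3)),
      v t y = UnboundedOperators.heatExtension (v s) (t - s) y - oseenDuhamel 1 s v v t y)
    (hdiv : ∀ t < 0, VectorCalculus.IsDivFree (v t))
    {s : ℝ} (hs : s < 0) {e : (EuclideanSpace ℝ (Fin 3))} (hal : ∀ y, cross (curl (v s) y) e = 0) :
    ∀ t < 0, ∀ (y : (EuclideanSpace ℝ (Fin 3))) (l : ℝ), v t (y + l • e) = v t y := by
  have hC : ContDiff ℝ 3 (v s) := (analyticOnNhd_slice hcont hbdd hmild hs).contDiff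
  obtain ⟨B, hB⟩ := hbdd (-s / 2) (by linarith)
  have hbd : ∀ y, ‖v s y‖ ≤ B := fun y => hB s (by linarith) y
  obtain ⟨M', hM'⟩ := exists_fderiv_slice_bound hcont hbdd hmild hs
  have hinv : ∀ (y : (EuclideanSpace ℝ (Fin 3))) (l : ℝ), v s (y + l • e) = v s y := fun y l =>
    translate_eq_of_cross_curl_eq_zero hC (hdiv s hs) hbd hM' hal y l
  exact translate_eq_backward hcont hbdd hmild hs
    (translate_eq_forward hcont hbdd hmild hinv)

/-- `EuclideanSpace.single 1 δ' = δ' • e₂`. -/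
theorem single_one_eq_smul (δ' : ℝ) :
    (EuclideanSpace.single (1 : Fin 3) δ' : (EuclideanSpace ℝ (Fin 3))) = δ' • EuclideanSpace.single (1 : Fin 3) (1 : ℝ) := by
  ext j
  simp only [EuclideanSpace.single, PiLp.single_apply, PiLp.smul_apply, smul_eq_mul, mul_ite, mul_one, mul_zero]

/-- **(N₁) ancient planar Liouville with the Type-I rate** (KNSS 2009, proof of Thm 6.2, Liouville step; tree
THEOREM `KNSS2009_typeI_rate_liouville_holds` + rotation to the axis `e₂` + time shift): a Type-I-rate,
continuous, Oseen-mild, divergence-free field on `(−∞,0) × ℝ³` all of whose slices are invariant under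
translations along some `e ≠ 0` vanishes identically. -/
theorem eq_zero_of_translate_eq {C : ℝ} (hrate : HasTypeITimeDecay C v)
    (hcont : ContinuousOn (uncurry v) (Iio (0 : ℝ) ×ˢ univ))
    (hmild : ∀ s t : ℝ, s < t → t < 0 → ∀ y : (EuclideanSpace ℝ (Fin 3)),
      v t y = UnboundedOperators.heatExtension (v s) (t - s) y - oseenDuhamel 1 s v v t y)
    (hdiv : ∀ t < 0, VectorCalculus.IsDivFree (v t)) {e : (EuclideanSpace ℝ (Fin 3))} (he : e ≠ 0)
    (hinv : ∀ t < 0, ∀ (y : (EuclideanSpace ℝ (Fin 3))) (l : ℝ), v t (y + l • e) = v t y) : ∀ t < 0, ∀ y, v t y = 0 := by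
  have hbdd := bdd_of_hasTypeITimeDecay hrate
  -- the unit vector `ê` and the reflection `R` with `R e₂ = ê`; `L := R⁻¹`
  set ehat : (EuclideanSpace ℝ (Fin 3)) := (‖e‖⁻¹ : ℝ) • e with hehat
  have hehat1 : ‖ehat‖ = 1 := norm_smul_inv_norm he
  have he2 : ‖(EuclideanSpace.single (1 : Fin 3) (1 : ℝ) : (EuclideanSpace ℝ (Fin 3)))‖ = ‖ehat‖ := by
    rw [EuclideanSpace.single, PiLp.norm_single, norm_one, hehat1]
  set R : (EuclideanSpace ℝ (Fin 3)) ≃ₗᵢ[ℝ] (EuclideanSpace ℝ (Fin 3)) := Submodule.reflection (ℝ ∙ (EuclideanSpace.single (1 : Fin 3) (1 : ℝ) - ehat))ᗮ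
    with hR
  have hRe : R (EuclideanSpace.single (1 : Fin 3) (1 : ℝ)) = ehat := Submodule.reflection_sub he2
  set L : (EuclideanSpace ℝ (Fin 3)) ≃ₗᵢ[ℝ] (EuclideanSpace ℝ (Fin 3)) := R.symm with hL
  have hLs : ∀ x, L.symm x = R x := fun x => by rw [hL, LinearIsometryEquiv.symm_symm]
  -- it suffices to prove vanishing on every shifted slab
  suffices key : ∀ δ : ℝ, 0 < δ → ∀ t < 0, ∀ x : (EuclideanSpace ℝ (Fin 3)), v (t + -δ) (L.symm x) = 0 by
    intro t ht y
    have h := key (-t / 2) (by linarith) (t / 2) (by linarith) (L y)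
    rw [LinearIsometryEquiv.symm_apply_apply] at h
    have htt : t / 2 + -(-t / 2) = t := by ring
    rwa [htt] at h
  intro δ hδ
  obtain ⟨hc', ⟨M, hM⟩, hm'⟩ := shift hcont hbdd hmild hδ
  -- the conjugated, shifted field
  set u : ℝ → (EuclideanSpace ℝ (Fin 3)) → (EuclideanSpace ℝ (Fin 3)) := fun t x => L (v (t + -δ) (L.symm x)) with hu
  have hLiou := KNSS2009_typeI_rate_liouville_holds (C := C) (W := u)
  -- (a) continuity
  have ha : ContinuousOn (uncurry u) (Iio (0 : ℝ) ×ˢ univ) := by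
    have h1 : ContinuousOn (fun p : ℝ × (EuclideanSpace ℝ (Fin 3)) => (p.1, L.symm p.2)) (Iio (0 : ℝ) ×ˢ univ) :=
      (continuous_fst.prodMk (L.symm.continuous.comp continuous_snd)).continuousOn
    have h2 : MapsTo (fun p : ℝ × (EuclideanSpace ℝ (Fin 3)) => (p.1, L.symm p.2)) (Iio (0 : ℝ) ×ˢ univ) (Iio 0 ×ˢ univ) :=
      fun p hp => mem_prod.2 ⟨(mem_prod.1 hp).1, mem_univ _⟩
    exact L.continuous.comp_continuousOn (hc'.comp h1 h2)
  -- (b) global bound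
  have hb : ∃ K : ℝ, ∀ t < 0, ∀ x, ‖u t x‖ ≤ K :=
    ⟨M, fun t ht x => by rw [hu]; dsimp only; rw [L.norm_map]; exact hM t ht _⟩
  -- (c) weakly divergence-free slices
  have hc : ∀ t < 0, IsWeaklyDivFree (u t) := by
    intro t ht
    have htδ : t + -δ < 0 := by linarith
    have hsm : ContDiff ℝ 1 (v (t + -δ)) := (analyticOnNhd_slice hcont hbdd hmild htδ).contDiff
    have hdiv' : VectorCalculus.IsDivFree (fun y => L (v (t + -δ) (L.symm y))) :=
      (hdiv (t + -δ) htδ).conj_linearIsometryEquiv L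
    exact VectorCalculus.IsDivFree.isWeaklyDivFree_holds hdiv'
      (L.contDiff.comp (hsm.comp L.symm.contDiff))
  -- (d) the Oseen identity, by covariance
  have hd : ∀ s t : ℝ, s < t → t < 0 → ∀ x,
      u t x = UnboundedOperators.heatExtension (u s) (t - s) x - oseenDuhamel 1 s u u t x := by
    intro s t hst ht0 x
    have h1 : UnboundedOperators.heatExtension (u s) (t - s) x =
        L (UnboundedOperators.heatExtension (v (s + -δ)) (t - s) (L.symm x)) :=
      heatExtension_conj_linearIsometryEquiv L (v (s + -δ)) (t - s) x
    have h2 := oseenDuhamel_symm_conj_linearIsometryEquiv L.symm 1 s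
      (fun τ => v (τ + -δ)) (fun τ => v (τ + -δ)) t x
    simp only [LinearIsometryEquiv.symm_symm] at h2
    have h3 := hm' s t hst ht0 (L.symm x)
    dsimp only at h3
    show L (v (t + -δ) (L.symm x)) = _
    rw [h1, h2, h3, map_sub]
  -- (e) invariance along `e₂`
  have he' : ∀ t < 0, ∀ (x : (EuclideanSpace ℝ (Fin 3))) (δ' : ℝ), u t (x + EuclideanSpace.single 1 δ') = u t x := by
    intro t ht x δ'
    have htδ : t + -δ < 0 := by linarith
    show L (v (t + -δ) (L.symm (x + EuclideanSpace.single 1 δ'))) = L (v (t + -δ) (L.symm x))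
    rw [map_add, single_one_eq_smul, LinearIsometryEquiv.map_smul, hLs (EuclideanSpace.single 1 1),
      hRe, hehat, smul_smul]
    rw [hinv (t + -δ) htδ (L.symm x) (δ' * ‖e‖⁻¹)]
  -- (f) the rate only improves under the shift
  have hf : ∀ t < 0, ∀ x, Real.sqrt (-t) * ‖u t x‖ ≤ C := by
    intro t ht x
    have htδ : t + -δ < 0 := by linarith
    have hnorm : ‖u t x‖ = ‖v (t + -δ) (L.symm x)‖ := by rw [hu]; dsimp only; rw [L.norm_map]
    have hr := hrate (t + -δ) htδ (L.symm x)
    have hspos : 0 < Real.sqrt (-(t + -δ)) := Real.sqrt_pos.2 (by linarith)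
    have hle : Real.sqrt (-t) ≤ Real.sqrt (-(t + -δ)) := Real.sqrt_le_sqrt (by linarith)
    rw [hnorm]
    calc Real.sqrt (-t) * ‖v (t + -δ) (L.symm x)‖
        ≤ Real.sqrt (-(t + -δ)) * ‖v (t + -δ) (L.symm x)‖ :=
          mul_le_mul_of_nonneg_right hle (norm_nonneg _)
      _ ≤ Real.sqrt (-(t + -δ)) * (C / Real.sqrt (-(t + -δ))) :=
          mul_le_mul_of_nonneg_left hr hspos.le
      _ = C := by field_simp
  intro t ht x
  have h0 := hLiou ha hb hc hd he' hf t ht x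
  have h0' : L (v (t + -δ) (L.symm x)) = 0 := h0
  exact (LinearIsometryEquiv.map_eq_zero_iff L).1 h0'

/-- **Door 2C restricted to Type-I profiles.**  A Type-I-rate, continuous, Oseen-mild, divergence-free field on
`(−∞,0) × ℝ³` whose vorticity at ONE negative time `s` is parallel to a fixed `e ≠ 0` on ONE nonempty open set
vanishes identically. -/
theorem eq_zero_of_aligned_window {C : ℝ} (hrate : HasTypeITimeDecay C v)
    (hcont : ContinuousOn (uncurry v) (Iio (0 : ℝ) ×ˢ univ))
    (hmild : ∀ s t : ℝ, s < t → t < 0 → ∀ y : (EuclideanSpace ℝ (Fin 3)),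
      v t y = UnboundedOperators.heatExtension (v s) (t - s) y - oseenDuhamel 1 s v v t y)
    (hdiv : ∀ t < 0, VectorCalculus.IsDivFree (v t)) {s : ℝ} (hs : s < 0) {e : (EuclideanSpace ℝ (Fin 3))} (he : e ≠ 0)
    {U : Set (EuclideanSpace ℝ (Fin 3))} (hU : IsOpen U) (hne : U.Nonempty) (hal : ∀ y ∈ U, cross (curl (v s) y) e = 0) :
    ∀ t < 0, ∀ y, v t y = 0 := by
  have hbdd := bdd_of_hasTypeITimeDecay hrate
  exact eq_zero_of_translate_eq hrate hcont hmild hdiv he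
    (translate_eq_of_cross_curl_eq_zero_slice hcont hbdd hmild hdiv hs
      (cross_curl_eq_zero_of_window hcont hbdd hmild hs e hU hne hal))

/-- The vorticity of every slice `v(t)`, `t < 0`, of a Type-I-rate, continuous, Oseen-mild field is continuous
(it is real-analytic). -/
theorem continuous_curl_slice {C : ℝ} (hrate : HasTypeITimeDecay C v)
    (hcont : ContinuousOn (uncurry v) (Iio (0 : ℝ) ×ˢ univ))
    (hmild : ∀ s t : ℝ, s < t → t < 0 → ∀ y : (EuclideanSpace ℝ (Fin 3)),
      v t y = UnboundedOperators.heatExtension (v s) (t - s) y - oseenDuhamel 1 s v v t y)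
    {t : ℝ} (ht : t < 0) : Continuous (curl (v t)) :=
  continuousOn_univ.1
    (analyticOnNhd_curl (analyticOnNhd_slice hcont (bdd_of_hasTypeITimeDecay hrate) hmild ht)).continuousOn

/-- **The route's crux `ProfileAlignedWindowRigidity` (stmt-NavierStokesRegularity-20018) is a THEOREM**: the type
of this declaration is literally the route decl.  RIGIDITY OF TYPE-I PROFILES WITH AN ALIGNED WINDOW: a
Type-I-rate, continuous, unit-viscosity Oseen-mild, divergence-free `v` on `(−∞,0) × ℝ³` has continuous vorticity
at `s = −1`, and if that vorticity is parallel to a fixed `e ≠ 0` on a nonempty open set then `v(t,·) ≡ 0` for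
every `t < 0`. -/
theorem profileAlignedWindowRigidity_proof :
    Summit.NavierStokesRegularity.NavierStokesRegularity.Theses.LocalSineTubeDoor.ProfileAlignedWindowRigidity := by
  intro C v hrate hcont hmild hdiv
  have h10 : (-1 : ℝ) < 0 := by norm_num
  exact ⟨continuous_curl_slice hrate hcont hmild h10,
    fun e he U hU hne hal => eq_zero_of_aligned_window hrate hcont hmild hdiv h10 he hU hne hal⟩

end Summit.NavierStokesRegularity.NavierStokesRegularity.Theorems.LocalSineTubeDoorProfileAlignedWindowRigidity

end
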